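import Summits.QuantumFields.YangMills.Theses.ForcedResponseSkewness
import Summits.QuantumFields.YangMills.Theorems.ForcedResponseSkewnessResponseLocalisationDefs
import Summits.QuantumFields.YangMills.Theorems.ForcedResponseSkewnessResponseLocalisationStubCollarOfKernel
import Summits.QuantumFields.YangMills.Theorems.ForcedResponseSkewnessFemtoOfFBL6

/-!
# Skeleton «femto-collar» for the deciding crux `ResponseLocalisation` (stmt-QuantumFields-24869; route
# `ForcedResponseSkewness` rev 5; lead `ym-line-frs-p1` g3, 2026-08-28) — successor of «collar-kernel» (same composition, the
# physics stub RESHAPED into the spine's femto currency)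

The crux (rev 5) is the contact half of response localisation: the δ-COLLAR share of the β-response of the clause-(i) two-point
function is `≤ η·(1 + |∂_cQ2|)` for sources in a shrinking positive-time ball.  Line «collar-kernel» (g2) cut it into the
kernel-level statement `ContactKernelSigR` (integrated near-insertion ceiling for the torus third cumulant along a pinned unit)
and the smearing reduction `stub_collarOfKernel` (LANDED, frs-p2 p600411).  This generation transfers the kernel statement ITSELF to
two FEMTO-CUBE statements by Georgii's conditional independence of separated volumes (one torus DLR step around each of `y`, `z` —
the tree's `abs_integral_prod_sub_mean_le`, exactly as the spine's `MomentBounds ⇐ FBL`):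

ResponseLocalisation ⇐ stub_collarOfKernel   (ANALYSIS, LANDED p600411: `ContactKernelSigR →` crux body)
                     ∘ contactKernel_of_femto (ANALYSIS, LANDED g3: `FBLPinnedSigR → NearCovLawSigR → ContactKernelSigR`;
                                               toolkit p605658 + cumulant helper + main file)
                     ∘ fblPinnedSigR_of_fbl6  (LANDED g3, tree `fbl_of_fbl6`: `FBL6PinnedSigR → FBLPinnedSigR`)
                     ⇐ stub_fbl6Pinned         (E0′/FEMTO class, THE SHARED ENGINE STUB OF THE ROUTE — registered on this crux AND on
                                               24275: the spine's plane-resolved frozen-boundary law `FBL6 G r a` of the record's femto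
                                               package `OSLegsFromFemtoAndGap` (`Statement.stub_fcp6`) — VERBATIM — along a pinned unit;
                                               on 24275 it yields `ScaleFreeLocalPinnedSigR` via tree `stub_collar6`)
                     + stub_nearCovLaw         (ASYMPTOTIC-FREEDOM class, femto currency, the line's ONE genuine debt: the
                                               near-pair conditional-covariance law `NearCovLaw G r a` — for every exterior η and
                                               femto cube, `|kerCov_η(dens (z+w), dens z) − n_β(w)| ≤ μ_β(w)/depth⁴` with a
                                               majorant SUMMABLE over the cut ball, `Σ_{a|w|<R} μ_β(w) ≤ κ` for `R = R(κ)`;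
                                               RG-improved one loop `μ_β(w) ≍ b₀ ḡ⁴(|w|a)/|w|⁴`, `Σ ≍ ḡ²(R) → 0`)
No torus, no volume, no unit-scale correlation is left in the physics stubs: torus-uniformity and the pair at unit-scale separation
are DERIVED (boundary-law smallness `C₁/D⁴ ≍ a(β)⁴` per cube, `D ≍ r₁/a(β)`).  Statements in
`Theorems/ForcedResponseSkewnessResponseLocalisationDefs.lean` (appends p605732, p607611).  No summit is proved by any of this (leaf R2a
`BalabanLadder.NT`, conditional on the residual 24873; the YM mass gap is NOT proved).
-/

set_option autoImplicit false

noncomputable section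

namespace Summit.QuantumFields.YangMills.Cruxes.ResponseLocalisation.Femto

open Summit.QuantumFields.YangMills.Cruxes.ResponseLocalisation.Birth
open Summit.QuantumFields.YangMills.Cruxes.ResponseLocalisation.Collar (stub_collarOfKernel)
open Summit.QuantumFields.YangMills.Theses.ForcedResponseSkewness

/-! ## The registered stubs -/

theorem stub_fbl6Pinned : FBL6PinnedSigR := by
  sorry

theorem stub_nearCovLaw : NearCovLawSigR := by
  sorry

-- contactKernel_of_fbl6 : FBL6PinnedSigR → NearCovLawSigR → ContactKernelSigR — LANDED (lead g3,
-- Theorems/ForcedResponseSkewnessFemtoOfFBL6.lean ∘ …ContactOfFemto.lean, this namespace), imported above.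
-- stub_collarOfKernel : CollarOfKernelSigR — LANDED (frs-p2 p600411), imported above.

/-- COMPOSITION (kernel-checked): smearing reduction ∘ collar transfer applied to the two femto stubs IS the crux. -/
theorem ResponseLocalisation_holds : ResponseLocalisation :=
  stub_collarOfKernel (contactKernel_of_fbl6 stub_fbl6Pinned stub_nearCovLaw)

end Summit.QuantumFields.YangMills.Cruxes.ResponseLocalisation.Femto

end
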